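import Mathlib
import HarnessLib
import Literature.NumberTheory.GaloisRepresentations.Pseudocharacter

/-!
# Route `EisensteinGelfandKirillov`, crux `ProModularOfGKBound` (stmt-Langlands-18273), line
# `two-leaf-fern`: compact Hausdorff local rings and pseudocharacters with discrete coefficients
# (infrastructure for `stub_noetherianOf`, part 1 of 3)

The registered stub `stub_noetherianOf` (file `…StubNoetherianOf.lean`) derives the Noetherianity of the
coefficient ring `ℋ.R` of every pseudo-deformation host from Chenevier's universal deformation ring of a
`2`-dimensional residual determinant [cite: Chenevier2014, §3.1 Prop. 3.3 and Prop. 3.7] and Mazur's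
`Φ_p` for `G_{F,S}`.  To APPLY that universal property one needs: the residue field of the compact
Hausdorff local ring `ℋ.R` is finite and discrete (so that the residual determinant is a continuous
determinant over a finite field), and continuous pseudocharacters descend through quotients.  This file
proves these self-contained facts (no deformation theory, no number fields):

* §1 compact Hausdorff commutative rings: the units form a closed set (`isClosed_setOf_isUnit`); in the
  LOCAL case the maximal ideal is clopen (`isOpen_maximalIdeal_of_compact`, no Noetherian hypothesis —
  contrast Mathlib's `IsLocalRing.isOpen_maximalIdeal`), the residue field is finite and the quotient
  topology on it is discrete (`finite_residueField_of_compact`,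
  `discreteTopology_quotient_maximalIdeal_of_compact`), a uniform tube lemma
  (`exists_nhds_zero_mul_subset`), and every element of the maximal ideal is topologically nilpotent
  (`tendsto_pow_of_mem_maximalIdeal`, via idempotents of compact semigroups);
* §2 continuous pseudocharacters: descent through a quotient `G ⧸ N` by a normal subgroup of Taylor's
  kernel (`pseudocharacterDescend`), and openness of Taylor's kernel for a compact group and a discrete
  coefficient ring (`isOpen_ker_of_discreteTopology`: such a pseudocharacter factors through a finite
  quotient).

The file closes with the registered sub-goal `stub_noetherianAux1` (maximal ideal open and residue field
finite, in `∀`-form).  Parts 2 (`…StubNoetherianDeterminant.lean`: `2`-dimensional pseudocharacters are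
Chenevier determinants; consequences for hosts) and 3 (`…StubNoetherianOf.lean`) follow.
-/

set_option linter.dupNamespace false
set_option autoImplicit false

noncomputable section

open Filter Topology
open Literature.NumberTheory.GaloisRepresentations

namespace Summit.Langlands.Langlands.Cruxes.ProModularOfGKBound.TwoLeafFern

/-! ## 1. Compact Hausdorff commutative rings -/

section CompactRing

variable {R : Type*} [CommRing R] [TopologicalSpace R] [IsTopologicalRing R] [CompactSpace R]
  [T2Space R]

/-- In a compact Hausdorff topological ring the set of units is closed: it is the projection of the
compact set `{(x, y) | x y = 1}`. [folklore] -/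
theorem isClosed_setOf_isUnit : IsClosed {x : R | IsUnit x} := by
  have h : {x : R | IsUnit x} = Prod.fst '' {q : R × R | q.1 * q.2 = 1} := by
    ext x
    simp only [Set.mem_setOf_eq, Set.mem_image]
    constructor
    · rintro ⟨u, rfl⟩
      exact ⟨((u : R), ((u⁻¹ : Rˣ) : R)), u.mul_inv, rfl⟩
    · rintro ⟨⟨a, b⟩, hab, rfl⟩
      exact IsUnit.of_mul_eq_one b hab
  rw [h]
  exact ((isClosed_eq (continuous_fst.mul continuous_snd) continuous_const).isCompact.image
    continuous_fst).isClosed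

omit [T2Space R] in
/-- A uniform tube lemma at `0`: for every neighbourhood `V` of `0` in a compact topological ring there is
a neighbourhood `W` of `0` with `W · R ⊆ V`. [folklore] -/
theorem exists_nhds_zero_mul_subset {V : Set R} (hV : V ∈ 𝓝 (0 : R)) :
    ∃ W ∈ 𝓝 (0 : R), ∀ w ∈ W, ∀ r : R, w * r ∈ V := by
  obtain ⟨V', hV'V, hV'o, h0⟩ := mem_nhds_iff.1 hV
  have hn : IsOpen ((fun q : R × R => q.1 * q.2) ⁻¹' V') :=
    hV'o.preimage (continuous_fst.mul continuous_snd)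
  have hsub : ({0} : Set R) ×ˢ (Set.univ : Set R) ⊆ (fun q : R × R => q.1 * q.2) ⁻¹' V' := by
    rintro ⟨a, b⟩ ⟨ha, -⟩
    have ha0 : a = 0 := ha
    show a * b ∈ V'
    rw [ha0, zero_mul]
    exact h0
  obtain ⟨u, v, hu, -, h0u, huniv, huv⟩ :=
    generalized_tube_lemma isCompact_singleton isCompact_univ hn hsub
  refine ⟨u, hu.mem_nhds (h0u (Set.mem_singleton 0)), fun w hw r => hV'V ?_⟩
  exact huv (Set.mk_mem_prod hw (huniv (Set.mem_univ r)))

variable [IsLocalRing R]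

/-- **The maximal ideal of a compact Hausdorff local ring is open** (the complement of the closed set
of units).  No Noetherian hypothesis (contrast Mathlib's `IsLocalRing.isOpen_maximalIdeal`). [folklore] -/
theorem isOpen_maximalIdeal_of_compact :
    IsOpen ((IsLocalRing.maximalIdeal R : Ideal R) : Set R) := by
  have h : ((IsLocalRing.maximalIdeal R : Ideal R) : Set R) = {x : R | IsUnit x}ᶜ := by
    ext x
    simp [IsLocalRing.mem_maximalIdeal, mem_nonunits_iff]
  rw [h]
  exact isClosed_setOf_isUnit.isOpen_compl

/-- The maximal ideal of a compact Hausdorff local ring is closed (an open additive subgroup is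
closed). [folklore] -/
theorem isClosed_maximalIdeal_of_compact :
    IsClosed ((IsLocalRing.maximalIdeal R : Ideal R) : Set R) :=
  (IsLocalRing.maximalIdeal R).toAddSubgroup.isClosed_of_isOpen isOpen_maximalIdeal_of_compact

/-- The residue ring `R ⧸ 𝔪_R` of a compact Hausdorff local ring is finite (`𝔪_R` is an open subgroup
of the compact additive group `R`). [folklore] -/
theorem finite_quotient_maximalIdeal_of_compact : Finite (R ⧸ IsLocalRing.maximalIdeal R) :=
  AddSubgroup.quotient_finite_of_isOpen (IsLocalRing.maximalIdeal R).toAddSubgroup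
    isOpen_maximalIdeal_of_compact

/-- **The residue field of a compact Hausdorff local ring is finite.**  No Noetherian hypothesis
(contrast Mathlib's instance `IsLocalRing.finite_residueField_of_compactSpace`). [folklore] -/
theorem finite_residueField_of_compact : Finite (IsLocalRing.ResidueField R) :=
  finite_quotient_maximalIdeal_of_compact

/-- The quotient topology on `R ⧸ 𝔪_R` is discrete (`𝔪_R` is open). [folklore] -/
theorem discreteTopology_quotient_maximalIdeal_of_compact :
    DiscreteTopology (R ⧸ IsLocalRing.maximalIdeal R) :=
  QuotientAddGroup.discreteTopology (N := (IsLocalRing.maximalIdeal R).toAddSubgroup)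
    isOpen_maximalIdeal_of_compact

omit [IsTopologicalRing R] [CompactSpace R] [T2Space R] in
/-- The residue map `R → R ⧸ 𝔪_R` is continuous (quotient topology). [folklore] -/
theorem continuous_mk_maximalIdeal :
    Continuous (Ideal.Quotient.mk (IsLocalRing.maximalIdeal R)) :=
  continuous_quot_mk

/-- In a local ring an idempotent of the maximal ideal is `0` (`1 - e` is a unit and `(1 - e) e = 0`).
[folklore] -/
theorem eq_zero_of_idempotent_of_mem_maximalIdeal {S : Type*} [CommRing S] [IsLocalRing S] {e : S}
    (he : e ∈ IsLocalRing.maximalIdeal S) (hee : e * e = e) : e = 0 := by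
  have h1e : IsUnit (1 - e) := by
    by_contra h
    have h1 : (1 : S) ∈ IsLocalRing.maximalIdeal S := by
      have := Ideal.add_mem _ ((IsLocalRing.mem_maximalIdeal _).2 h) he
      rwa [sub_add_cancel] at this
    exact (IsLocalRing.maximalIdeal.isMaximal S).ne_top ((Ideal.eq_top_iff_one _).2 h1)
  have h2 : (1 - e) * e = 0 := by rw [sub_mul, one_mul, hee, sub_self]
  exact h1e.mul_right_eq_zero.1 h2

/-- **Elements of the maximal ideal of a compact Hausdorff local ring are topologically nilpotent**:
`x ∈ 𝔪_R ⇒ x^n → 0`.  Proof: the closure of the positive powers of `x` is a compact commutative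
semigroup, hence contains an idempotent (`exists_idempotent_in_compact_subsemigroup`), which lies in the
closed ideal `𝔪_R` and so is `0`; thus some power `x^N` enters any neighbourhood `W` of `0` with
`W · R ⊆ V` (`exists_nhds_zero_mul_subset`), and then `x^n = x^N x^{n-N} ∈ V` for all `n ≥ N`.
(In particular `p^n → 0` in every host.) [folklore] -/
theorem tendsto_pow_of_mem_maximalIdeal {x : R} (hx : x ∈ IsLocalRing.maximalIdeal R) :
    Tendsto (fun n : ℕ => x ^ n) atTop (𝓝 0) := by
  set s : Set R := closure (Set.range fun n : ℕ => x ^ (n + 1)) with hs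
  have hs_mul : ∀ a ∈ s, ∀ b ∈ s, a * b ∈ s := by
    intro a ha b hb
    refine map_mem_closure₂ (f := fun a b : R => a * b) continuous_mul ha hb ?_
    rintro _ ⟨m, rfl⟩ _ ⟨n, rfl⟩
    exact ⟨m + n + 1, by ring⟩
  obtain ⟨e, hes, hee⟩ := exists_idempotent_in_compact_subsemigroup (M := R)
    (fun r => continuous_id.mul continuous_const) s ⟨x ^ (0 + 1), subset_closure ⟨0, rfl⟩⟩
    isClosed_closure.isCompact hs_mul
  have hsm : s ⊆ (IsLocalRing.maximalIdeal R : Set R) := by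
    refine closure_minimal ?_ isClosed_maximalIdeal_of_compact
    rintro _ ⟨n, rfl⟩
    show x ^ (n + 1) ∈ (IsLocalRing.maximalIdeal R : Set R)
    rw [pow_succ]
    exact Ideal.mul_mem_left _ _ hx
  have he0 : e = 0 := eq_zero_of_idempotent_of_mem_maximalIdeal (hsm hes) hee
  rw [tendsto_nhds]
  intro V hVo hV0
  obtain ⟨W, hW, hWV⟩ := exists_nhds_zero_mul_subset (hVo.mem_nhds hV0)
  have h0s : (0 : R) ∈ s := he0 ▸ hes
  obtain ⟨y, hyW, N, hN⟩ := mem_closure_iff_nhds.1 h0s W hW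
  rw [mem_atTop_sets]
  refine ⟨N + 1, fun n hn => ?_⟩
  obtain ⟨k, rfl⟩ := Nat.exists_eq_add_of_le hn
  have hN' : x ^ (N + 1) = y := hN
  show x ^ (N + 1 + k) ∈ V
  rw [pow_add, hN']
  exact hWV y hyW _

/-- If a natural number `p` lies in the maximal ideal of a compact Hausdorff local ring then `p^n → 0`
(`p` is topologically nilpotent). [folklore] -/
theorem tendsto_natCast_pow_of_mem_maximalIdeal {p : ℕ}
    (hp : ((p : ℕ) : R) ∈ IsLocalRing.maximalIdeal R) :
    Tendsto (fun n : ℕ => ((p : ℕ) : R) ^ n) atTop (𝓝 0) :=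
  tendsto_pow_of_mem_maximalIdeal hp

omit [TopologicalSpace R] [IsTopologicalRing R] [CompactSpace R] [T2Space R] in
/-- If a prime `p` lies in the maximal ideal of a local ring, the residue field has characteristic `p`.
[folklore] -/
theorem charP_residueField_of_mem_maximalIdeal {p : ℕ} [hp : Fact p.Prime]
    (hpm : ((p : ℕ) : R) ∈ IsLocalRing.maximalIdeal R) :
    CharP (IsLocalRing.ResidueField R) p := by
  have h0 : ((p : ℕ) : IsLocalRing.ResidueField R) = 0 := by
    rw [← map_natCast (IsLocalRing.residue R), IsLocalRing.residue_eq_zero_iff]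
    exact hpm
  exact (CharP.charP_iff_prime_eq_zero hp.out).2 h0

end CompactRing

/-! ## 2. Continuous pseudocharacters: descent through a quotient, open kernels -/

section Descent

variable {G : Type*} [Group G] [TopologicalSpace G] {A : Type*} [CommRing A] [TopologicalSpace A]
  {d : ℕ} (T : ContinuousPseudocharacter G A d) (N : Subgroup G) (hN : N ≤ T.ker)

/-- The function on `G ⧸ N` induced by a continuous pseudocharacter `T` of `G` when the normal subgroup
`N` lies in Taylor's kernel of `T` (`T (g n) = T g`). [cite: Taylor1991, §1] -/
def descendFun : G ⧸ N → A := fun q =>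
  Quotient.liftOn' q T fun a b hab => by
    have h : a⁻¹ * b ∈ N := QuotientGroup.leftRel_apply.mp hab
    have h2 := (ContinuousPseudocharacter.mem_ker.mp (hN h)) a
    rw [mul_inv_cancel_left] at h2
    exact h2.symm

/-- `descendFun` on classes. [folklore] -/
@[simp] theorem descendFun_mk (g : G) : descendFun T N hN (g : G ⧸ N) = T g := rfl

/-- `descendFun ∘ mk = T`. [folklore] -/
theorem descendFun_comp_mk : descendFun T N hN ∘ ((↑) : G → G ⧸ N) = T := rfl

/-- **Descent of a continuous pseudocharacter through a quotient by a normal subgroup of its Taylor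
kernel**: `T` induces a continuous pseudocharacter of the same dimension on `G ⧸ N` (continuity because
`G → G ⧸ N` is a quotient map; the Frobenius identity by lifting tuples). [cite: Taylor1991, §1] -/
def pseudocharacterDescend [N.Normal] [IsTopologicalGroup G] :
    ContinuousPseudocharacter (G ⧸ N) A d where
  toFun := descendFun T N hN
  isPseudocharacter_toFun :=
    { map_one := by rw [← QuotientGroup.mk_one, descendFun_mk, T.map_one]
      map_mul_comm := by
        intro a b
        obtain ⟨a, rfl⟩ := QuotientGroup.mk_surjective a
        obtain ⟨b, rfl⟩ := QuotientGroup.mk_surjective b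
        rw [← QuotientGroup.mk_mul, ← QuotientGroup.mk_mul, descendFun_mk, descendFun_mk,
          T.map_mul_comm]
      frobenius := by
        intro x
        obtain ⟨y, rfl⟩ : ∃ y : Fin (d + 1) → G, (QuotientGroup.mk' N) ∘ y = x :=
          ⟨fun i => (QuotientGroup.mk_surjective (x i)).choose,
            funext fun i => (QuotientGroup.mk_surjective (x i)).choose_spec⟩
        rw [← frobeniusS_comp]
        exact T.frobenius y }
  continuous_toFun := by
    rw [(QuotientGroup.isQuotientMap_mk N).continuous_iff]
    exact T.continuous

/-- `pseudocharacterDescend` on classes. [folklore] -/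
@[simp] theorem pseudocharacterDescend_mk [N.Normal] [IsTopologicalGroup G] (g : G) :
    pseudocharacterDescend T N hN (g : G ⧸ N) = T g := rfl

end Descent

section OpenKernel

/-- **Taylor's kernel of a continuous pseudocharacter of a compact group with values in a discrete ring
is open** (so the pseudocharacter factors through a finite quotient): `(g', w) ↦ T (g' w)` is locally
constant, so around each `(g, 1)` there is a box `U_g × W_g` on which `T (g' w) = T g'`; finitely many
`U_g` cover `G` and the intersection of the corresponding `W_g` lies in the kernel. [folklore] -/
theorem isOpen_ker_of_discreteTopology {G : Type*} [Group G] [TopologicalSpace G]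
    [IsTopologicalGroup G] [CompactSpace G] {A : Type*} [CommRing A] [TopologicalSpace A]
    [DiscreteTopology A] {d : ℕ} (T : ContinuousPseudocharacter G A d) :
    IsOpen (T.ker : Set G) := by
  have key : ∀ g : G, ∃ U ∈ 𝓝 g, ∃ W ∈ 𝓝 (1 : G), ∀ g' ∈ U, ∀ w ∈ W, T (g' * w) = T g' := by
    intro g
    have hc : Continuous fun q : G × G => T (q.1 * q.2) :=
      T.continuous.comp (continuous_fst.mul continuous_snd)
    have ho : IsOpen ((fun q : G × G => T (q.1 * q.2)) ⁻¹' {T g}) :=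
      (isOpen_discrete _).preimage hc
    have hmem : (g, (1 : G)) ∈ (fun q : G × G => T (q.1 * q.2)) ⁻¹' {T g} := by
      simp
    obtain ⟨U, W, hU, hW, hgU, h1W, hUW⟩ := isOpen_prod_iff.1 ho g 1 hmem
    refine ⟨U, hU.mem_nhds hgU, W, hW.mem_nhds h1W, fun g' hg' w hw => ?_⟩
    have h1 : T (g' * w) = T g := hUW (Set.mk_mem_prod hg' hw)
    have h2 : T (g' * 1) = T g := hUW (Set.mk_mem_prod hg' h1W)
    rw [mul_one] at h2
    rw [h1, h2]
  choose U hU W hW hUW using key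
  obtain ⟨t, ht⟩ := CompactSpace.elim_nhds_subcover U hU
  have hW₀ : (⋂ g ∈ t, W g) ∈ 𝓝 (1 : G) := (Filter.biInter_finset_mem t).2 fun g _ => hW g
  refine Subgroup.isOpen_of_mem_nhds T.ker (Filter.mem_of_superset hW₀ fun w hw => ?_)
  rw [SetLike.mem_coe, ContinuousPseudocharacter.mem_ker]
  intro g
  have hg : g ∈ ⋃ x ∈ t, U x := by rw [ht]; exact Set.mem_univ g
  obtain ⟨i, hi, hgi⟩ := Set.mem_iUnion₂.1 hg
  exact hUW i g hgi w (Set.mem_iInter₂.1 hw i hi)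

/-- Hence such a pseudocharacter factors through a FINITE quotient: `G ⧸ ker T` is finite.
[folklore] -/
theorem finite_quotient_ker_of_discreteTopology {G : Type*} [Group G] [TopologicalSpace G]
    [IsTopologicalGroup G] [CompactSpace G] {A : Type*} [CommRing A] [TopologicalSpace A]
    [DiscreteTopology A] {d : ℕ} (T : ContinuousPseudocharacter G A d) :
    Finite (G ⧸ T.ker) :=
  Subgroup.quotient_finite_of_isOpen T.ker (isOpen_ker_of_discreteTopology T)

end OpenKernel

/-! ## Registered sub-goal -/

/-- **Sub-goal `stub_noetherianAux1` of `stub_noetherianOf`**: in a compact Hausdorff local commutative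
topological ring the maximal ideal is open and the residue field is finite (no Noetherian hypothesis;
`isOpen_maximalIdeal_of_compact`, `finite_residueField_of_compact`). [folklore] -/
theorem stub_noetherianAux1 : ∀ (R : Type) [CommRing R] [TopologicalSpace R] [IsTopologicalRing R] [CompactSpace R] [T2Space R] [IsLocalRing R], IsOpen ((IsLocalRing.maximalIdeal R : Ideal R) : Set R) ∧ Finite (IsLocalRing.ResidueField R) :=
  fun _ _ _ _ _ _ _ => ⟨isOpen_maximalIdeal_of_compact, finite_residueField_of_compact⟩

end Summit.Langlands.Langlands.Cruxes.ProModularOfGKBound.TwoLeafFern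

end
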